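import Summits.NavierStokesRegularity.FunctionalMining.TopEigStrainMixHeat
import HarnessLib

/-!
# FunctionalMining / NoGo — K11a (1/4): the radial maps `z ↦ (‖z‖² + η²)^b z` (`b > −1/2`), the
# tangent inequality of `z ↦ ‖z‖^q` for EVERY real `q > 1`, and the map `w ↦ ‖w‖^γ w` (`0 ≤ γ ≤ 1`)

HONEST FRAMING. Search for candidate a priori estimates; no regularity claim. Nothing about
Navier–Stokes is proved or asserted in this file: inequalities for smooth vector fields on the
flat torus along the HEAT line `v + tΔv` (no transport term, no pressure) and lemmas of real
analysis. Cell `pub-nsfunc`, no-go seat (gen 39). K11 = FOUR files, imported in this order: K11a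
`NoGo/StrainMomentLtTwoRadial` → K11b `NoGo/StrainMomentLtTwoLine` → K11c `NoGo/StrainMomentLtTwoReg`
→ K11d `NoGo/StrainMomentHeatCoerciveLtTwo` (the row); K12 = `NoGo/TopBotEigHeatCoerciveLtTwo`.

THE TARGET (K11d). The tree proves the heat row of the strain moment `Z_q = torusStrainMoment q =
∫|S|^q` — `TopEig.HeatCoercive Z_q c`: `c·Z_q(v) ≤ heatDissipation Z_q v = −(d/dt)⁺Z_q(v+tΔv)|₀` on
smooth divergence-free `v` — for real `q > 2` (`TopEigStrainHeatLine`, through the weighted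
dissipation `D_Z = ∫|S|^{q−2}|∇S|²` and `npConst q`) and at `q = 2` (K7/K8). BELOW `q = 2` the weight
`|S|^{q−2}` is singular on `{S = 0}` and no `D_Z` is available; K11 proves the row for EVERY REAL
`1 < q < 2` without ever forming a weighted dissipation at `ε = 0`:
`TopEig.strainMoment_heatCoercive_of_lt_two (hq1 : 1 < q) (hq2 : q < 2) : HeatCoercive Z_q (c_Z q)`,
`c_Z q = TopEig.zqRateLtTwo q = 2π²q(q−1)/(51(2−q/2)²)` (not sharp), in FIELD FORM (every smooth `v`).
K12 re-runs K9's mixture principle with this row: `TopBotEigSplitting q c → 0 < c →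
TopBotEigHeatCoercivePos q` for `1 < q < 2` (door D-K6 (c) below `q = 2` REDUCED to the splitting, which
is NOT proved below `q = 2`).

WHAT IS PROVED HERE [ours / folklore], in a real inner-product space `E` (pure real analysis):
* §1 `‖(‖z‖²+s)^b z‖ ≤ (‖z‖²+s)^{b+1/2}` (`s ≥ 0`, `b > −1/2`); **`TopEig.continuous_rpow_normSq_add_sq_smul
  (hb : −1/2 < b) : Continuous fun p : ℝ × E => (‖p.2‖² + p.1²)^b • p.2`** (squeeze at `(0,0)`,
  `rpow_const` elsewhere) and the slice `z ↦ (‖z‖²)^b z`.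
* §2 **`TopEig.norm_sq_rpow_sub_le_of_one_lt (hq : 1 < q)`**:
  `(‖x+τy‖²)^{q/2} − (‖x‖²)^{q/2} ≤ τ·(q(‖x+τy‖²)^{q/2−1}⟪x+τy, y⟫)` for all `x y τ` — the tree's `q > 2`
  pointwise step (`TopEigStrainHeatLine`) for every real `q > 1` (norm convex + Cauchy–Schwarz +
  `rpow_sub_rpow_le_tangent`; at `x + τy = 0` both `0`-conventions give `0`).
* §3 for `0 ≤ γ ≤ 1`: `s^γ − t^γ ≤ s^{γ−1}(s − t)` (`0 < t ≤ s`); **`‖‖x‖^γx − ‖y‖^γy‖ ≤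
  (‖x‖^γ + ‖y‖^γ)‖x − y‖`**; the inversion `‖W‖^γ W = S` for `W = (‖S‖²)^{b/2}S`, `γ(1+b) = −b`; and
  `‖(‖S‖²)^{b/2}S‖² = (‖S‖²)^{b+1}` (`b + 1 ≠ 0`).

WHAT IS NOT PROVED HERE. Anything on the torus or about the strain (K11b–d).

PROVENANCE / STATUS. Typed and farm-checked by the no-go seat (gen 39): K11a stand-alone, the others as
concatenations with the union of their tree imports (evidence `pub-nsfunc-nogo/sieveld/kth/`: check
JSONs, a negative control, the by-value file `zqRateLtTwo (3/2) = 8π²/425`). STATUS: STAGED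
(`pub-nsfunc-nogo/NoGo/<name>.STAGING.lean`); filing by a prove seat on the lead's word in the order
K11a → K11b → K11c → K11d → K12, after K8 `NoGo/TopBotEigHeatCoerciveTwoSharp` and K9
`NoGo/TopBotEigHeatCoerciveSplit` (both in the tree); the planner seat cannot file under
`FunctionalMining/`. No constant is claimed sharp. Search for candidate a priori estimates; no
regularity claim. [ours; K1-Q6 = door D-K6, heat side, `1 < q < 2`]
FILING (prove seat g26, REQUEST #25a): declarations byte-identical to the no-go seat's staged `StrainMomentLtTwoRadial.STAGING.lean` 85c7876cabf2ddd6; this line is the only addition.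
-/

noncomputable section

open MeasureTheory Finset Set Filter Topology
open scoped InnerProductSpace RealInnerProductSpace ContDiff Real

namespace Summit.NavierStokesRegularity.FunctionalMining

open Literature.Analysis.FunctionSpaces Literature.Analysis.FunctionSpaces.Torus
  Literature.Analysis.FluidPDE

namespace TopEig

open StrainL4 StrainMoment

/-! ## 1. The radial maps `z ↦ (‖z‖² + η²)^b z` for `b > −1/2`: a norm bound and joint continuity -/

section Radial

variable {E : Type*} [NormedAddCommGroup E] [InnerProductSpace ℝ E]

/-- `‖(‖z‖² + s)^b z‖ ≤ (‖z‖² + s)^{b + 1/2}` for `s ≥ 0` (`‖z‖ ≤ (‖z‖² + s)^{1/2}`). [folklore] -/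
theorem norm_rpow_normSq_add_smul_le (b : ℝ) {s : ℝ} (hs : 0 ≤ s) (z : E) :
    ‖(‖z‖ ^ 2 + s) ^ b • z‖ ≤ (‖z‖ ^ 2 + s) ^ (b + 1 / 2) := by
  have hm : 0 ≤ ‖z‖ ^ 2 + s := by positivity
  rw [norm_smul, Real.norm_of_nonneg (Real.rpow_nonneg hm _)]
  rcases hm.eq_or_lt with h0 | hpos
  · have hz : ‖z‖ = 0 := by nlinarith [norm_nonneg z, sq_nonneg ‖z‖]
    rw [hz, mul_zero]
    exact Real.rpow_nonneg (by positivity) _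
  · have hle : ‖z‖ ≤ (‖z‖ ^ 2 + s) ^ (1 / 2 : ℝ) := by
      rw [← Real.sqrt_eq_rpow]
      calc ‖z‖ = Real.sqrt (‖z‖ ^ 2) := (Real.sqrt_sq (norm_nonneg _)).symm
        _ ≤ Real.sqrt (‖z‖ ^ 2 + s) := Real.sqrt_le_sqrt (by linarith)
    calc (‖z‖ ^ 2 + s) ^ b * ‖z‖ ≤ (‖z‖ ^ 2 + s) ^ b * (‖z‖ ^ 2 + s) ^ (1 / 2 : ℝ) :=
          mul_le_mul_of_nonneg_left hle (Real.rpow_nonneg hm _)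
      _ = (‖z‖ ^ 2 + s) ^ (b + 1 / 2) := by rw [← Real.rpow_add hpos]

/-- **Joint continuity of `(η, z) ↦ (‖z‖² + η²)^b z` on `ℝ × E` for `b > −1/2`** (away from the
origin the base is positive; at the origin `‖·‖ ≤ (‖z‖² + η²)^{b+1/2} → 0`). [folklore] -/
theorem continuous_rpow_normSq_add_sq_smul {b : ℝ} (hb : -1 / 2 < b) :
    Continuous fun p : ℝ × E => (‖p.2‖ ^ 2 + p.1 ^ 2) ^ b • p.2 := by
  have hbase : Continuous fun p : ℝ × E => ‖p.2‖ ^ 2 + p.1 ^ 2 :=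
    (continuous_snd.norm.pow 2).add (continuous_fst.pow 2)
  refine continuous_iff_continuousAt.2 fun p => ?_
  by_cases hp : ‖p.2‖ ^ 2 + p.1 ^ 2 = 0
  · have hz2 : ‖p.2‖ ^ 2 = 0 := by nlinarith [sq_nonneg ‖p.2‖, sq_nonneg p.1]
    have hη2 : p.1 ^ 2 = 0 := by nlinarith [sq_nonneg ‖p.2‖, sq_nonneg p.1]
    have hz : p.2 = 0 := norm_eq_zero.1 (pow_eq_zero_iff two_ne_zero |>.1 hz2)
    have hη : p.1 = 0 := pow_eq_zero_iff two_ne_zero |>.1 hη2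
    have hg : Continuous fun p : ℝ × E => (‖p.2‖ ^ 2 + p.1 ^ 2) ^ (b + 1 / 2) :=
      hbase.rpow_const fun _ => Or.inr (by linarith)
    have hg0 : (‖p.2‖ ^ 2 + p.1 ^ 2) ^ (b + 1 / 2) = 0 := by
      rw [hp]; exact Real.zero_rpow (by linarith)
    have hgt : Tendsto (fun p : ℝ × E => (‖p.2‖ ^ 2 + p.1 ^ 2) ^ (b + 1 / 2)) (𝓝 p) (𝓝 0) := by
      have h := hg.continuousAt (x := p)
      rwa [ContinuousAt, hg0] at h
    have hf0 : (‖p.2‖ ^ 2 + p.1 ^ 2) ^ b • p.2 = 0 := by rw [hz, smul_zero]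
    show Tendsto (fun p : ℝ × E => (‖p.2‖ ^ 2 + p.1 ^ 2) ^ b • p.2) (𝓝 p)
      (𝓝 ((‖p.2‖ ^ 2 + p.1 ^ 2) ^ b • p.2))
    rw [hf0]
    exact squeeze_zero_norm (fun p' => norm_rpow_normSq_add_smul_le b (sq_nonneg p'.1) p'.2) hgt
  · exact (hbase.continuousAt.rpow_const (Or.inl hp)).smul continuousAt_snd

/-- Continuity of `z ↦ (‖z‖²)^b z` for `b > −1/2` (the `η = 0` slice). [folklore] -/
theorem continuous_rpow_normSq_smul {b : ℝ} (hb : -1 / 2 < b) :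
    Continuous fun z : E => (‖z‖ ^ 2) ^ b • z := by
  have h := (continuous_rpow_normSq_add_sq_smul (E := E) hb).comp
    (continuous_const.prodMk continuous_id : Continuous fun z : E => ((0 : ℝ), z))
  refine h.congr fun z => ?_
  simp [Function.comp]

/-! ## 2. The tangent inequality for `z ↦ (‖z‖²)^{q/2}`, every real `q > 1` -/

/-- **Gradient inequality of the convex `z ↦ ‖z‖^q` (`q > 1`) at `x + τy` in the direction `y`**,
in the `(‖·‖²)^{q/2}` format of `strainMoment_line_eq`:
`(‖x+τy‖²)^{q/2} − (‖x‖²)^{q/2} ≤ τ · q (‖x+τy‖²)^{q/2−1} ⟪x+τy, y⟫`. The norm is convex and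
`‖z‖(‖z‖ − ‖x‖) ≤ ⟪z, z − x⟫` (Cauchy–Schwarz); `s ↦ s^q` is convex (`rpow_sub_rpow_le_tangent`); at
`x + τy = 0` the conventions `0^{q/2−1} · 0 = 0` make it the trivial `−‖x‖^q ≤ 0`. This extends
`norm_sq_rpow_sub_le` (`q > 2`) to every real `q > 1`. [ours; elementary] -/
theorem norm_sq_rpow_sub_le_of_one_lt {q : ℝ} (hq : 1 < q) (x y : E) (τ : ℝ) :
    (‖x + τ • y‖ ^ 2) ^ (q / 2) - (‖x‖ ^ 2) ^ (q / 2) ≤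
      τ * (q * (‖x + τ • y‖ ^ 2) ^ (q / 2 - 1) * ⟪x + τ • y, y⟫_ℝ) := by
  have e1 : ∀ w : E, (‖w‖ ^ 2) ^ (q / 2) = ‖w‖ ^ q := fun w => by
    rw [← Real.rpow_natCast, ← Real.rpow_mul (norm_nonneg _)]
    congr 1; push_cast; ring
  rw [e1, e1]
  obtain ⟨z, hz⟩ : ∃ z : E, z = x + τ • y := ⟨_, rfl⟩
  rw [← hz]
  rcases eq_or_ne z 0 with h0 | h0
  · rw [h0, norm_zero, Real.zero_rpow (by linarith), inner_zero_left, mul_zero, mul_zero, zero_sub]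
    exact neg_nonpos.2 (Real.rpow_nonneg (norm_nonneg _) _)
  have hzn : 0 < ‖z‖ := norm_pos_iff.2 h0
  have e2 : (‖z‖ ^ 2) ^ (q / 2 - 1) = ‖z‖ ^ (q - 2) := by
    rw [← Real.rpow_natCast, ← Real.rpow_mul (norm_nonneg _)]
    congr 1; push_cast; ring
  rw [e2]
  have ht := rpow_sub_rpow_le_tangent hq hzn.le (norm_nonneg x)
  have hzx : z - x = τ • y := by rw [hz]; abel
  have hcs : ‖z‖ * (‖z‖ - ‖x‖) ≤ τ * ⟪z, y⟫_ℝ := by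
    have h1 : ⟪z, x⟫_ℝ ≤ ‖z‖ * ‖x‖ := real_inner_le_norm z x
    have h2 : τ * ⟪z, y⟫_ℝ = ⟪z, z⟫_ℝ - ⟪z, x⟫_ℝ := by
      rw [← inner_sub_right, hzx, real_inner_smul_right]
    rw [h2, real_inner_self_eq_norm_sq]
    nlinarith
  have hsplit : ‖z‖ ^ (q - 1) = ‖z‖ ^ (q - 2) * ‖z‖ := by
    rw [show q - 1 = (q - 2) + 1 by ring, Real.rpow_add hzn, Real.rpow_one]
  have hq0 : 0 ≤ q * ‖z‖ ^ (q - 2) := mul_nonneg (by linarith) (Real.rpow_nonneg hzn.le _)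
  calc ‖z‖ ^ q - ‖x‖ ^ q ≤ q * ‖z‖ ^ (q - 1) * (‖z‖ - ‖x‖) := ht
    _ = q * ‖z‖ ^ (q - 2) * (‖z‖ * (‖z‖ - ‖x‖)) := by rw [hsplit]; ring
    _ ≤ q * ‖z‖ ^ (q - 2) * (τ * ⟪z, y⟫_ℝ) := mul_le_mul_of_nonneg_left hcs hq0
    _ = τ * (q * ‖z‖ ^ (q - 2) * ⟪z, y⟫_ℝ) := by ring

/-! ## 3. The radial map `w ↦ ‖w‖^γ w` (`0 ≤ γ ≤ 1`): a two-sided Lipschitz-type bound, inversion,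
and mean control -/

/-- For `0 < t ≤ s` and `γ ≤ 1`: `s^γ − t^γ ≤ s^{γ−1}(s − t)` (`s^{γ−1} ≤ t^{γ−1}`). [folklore] -/
theorem rpow_sub_rpow_le_of_le_one {γ s t : ℝ} (hγ : γ ≤ 1) (ht : 0 < t) (hts : t ≤ s) :
    s ^ γ - t ^ γ ≤ s ^ (γ - 1) * (s - t) := by
  have hs : 0 < s := lt_of_lt_of_le ht hts
  have h1 : s ^ γ = s ^ (γ - 1) * s := by
    rw [show γ = (γ - 1) + 1 by ring, Real.rpow_add hs, Real.rpow_one]; ring_nf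
  have h2 : t ^ γ = t ^ (γ - 1) * t := by
    rw [show γ = (γ - 1) + 1 by ring, Real.rpow_add ht, Real.rpow_one]; ring_nf
  have h3 : s ^ (γ - 1) ≤ t ^ (γ - 1) := Real.rpow_le_rpow_of_nonpos ht hts (by linarith)
  have h4 : s ^ (γ - 1) * t ≤ t ^ (γ - 1) * t := mul_le_mul_of_nonneg_right h3 ht.le
  rw [h1, h2]
  nlinarith

variable {E' : Type*} [NormedAddCommGroup E'] [NormedSpace ℝ E']

/-- **`‖‖x‖^γ x − ‖y‖^γ y‖ ≤ (‖x‖^γ + ‖y‖^γ) ‖x − y‖`** for `0 ≤ γ ≤ 1` in any real normed space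
(with `‖y‖ ≤ ‖x‖`: `‖x‖^γx − ‖y‖^γy = ‖y‖^γ(x − y) + (‖x‖^γ − ‖y‖^γ)x` and
`(‖x‖^γ − ‖y‖^γ)‖x‖ ≤ ‖x‖^γ(‖x‖ − ‖y‖)`). [ours; elementary] -/
theorem norm_rpow_smul_sub_rpow_smul_le {γ : ℝ} (hγ0 : 0 ≤ γ) (hγ1 : γ ≤ 1) (x y : E') :
    ‖‖x‖ ^ γ • x - ‖y‖ ^ γ • y‖ ≤ (‖x‖ ^ γ + ‖y‖ ^ γ) * ‖x - y‖ := by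
  wlog hxy : ‖y‖ ≤ ‖x‖ generalizing x y
  · have h := this y x (le_of_not_ge hxy)
    rw [norm_sub_rev y x, add_comm] at h
    rwa [norm_sub_rev]
  have hsγ : 0 ≤ ‖x‖ ^ γ := Real.rpow_nonneg (norm_nonneg _) _
  have htγ : 0 ≤ ‖y‖ ^ γ := Real.rpow_nonneg (norm_nonneg _) _
  rcases eq_or_ne y 0 with hy | hy
  · subst hy
    simp only [smul_zero, sub_zero, norm_zero]
    rw [norm_smul, Real.norm_of_nonneg hsγ]
    have : 0 ≤ (0 : ℝ) ^ γ * ‖x‖ := mul_nonneg (Real.rpow_nonneg le_rfl _) (norm_nonneg _)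
    nlinarith
  have ht : 0 < ‖y‖ := norm_pos_iff.2 hy
  have hdec : ‖x‖ ^ γ • x - ‖y‖ ^ γ • y = ‖y‖ ^ γ • (x - y) + (‖x‖ ^ γ - ‖y‖ ^ γ) • x := by
    rw [smul_sub, sub_smul]; abel
  have hmono : ‖y‖ ^ γ ≤ ‖x‖ ^ γ := Real.rpow_le_rpow ht.le hxy hγ0
  have hkey : (‖x‖ ^ γ - ‖y‖ ^ γ) * ‖x‖ ≤ ‖x‖ ^ γ * ‖x - y‖ := by
    have h1 := rpow_sub_rpow_le_of_le_one hγ1 ht hxy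
    have h2 : ‖x‖ - ‖y‖ ≤ ‖x - y‖ := norm_sub_norm_le x y
    have hs : 0 < ‖x‖ := lt_of_lt_of_le ht hxy
    have h3 : ‖x‖ ^ (γ - 1) * ‖x‖ = ‖x‖ ^ γ := by
      rw [show γ = (γ - 1) + 1 by ring, Real.rpow_add hs, Real.rpow_one]; ring_nf
    calc (‖x‖ ^ γ - ‖y‖ ^ γ) * ‖x‖ ≤ ‖x‖ ^ (γ - 1) * (‖x‖ - ‖y‖) * ‖x‖ :=
          mul_le_mul_of_nonneg_right h1 (norm_nonneg _)
      _ = ‖x‖ ^ γ * (‖x‖ - ‖y‖) := by rw [← h3]; ring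
      _ ≤ ‖x‖ ^ γ * ‖x - y‖ := mul_le_mul_of_nonneg_left h2 hsγ
  rw [hdec]
  calc ‖‖y‖ ^ γ • (x - y) + (‖x‖ ^ γ - ‖y‖ ^ γ) • x‖
      ≤ ‖‖y‖ ^ γ • (x - y)‖ + ‖(‖x‖ ^ γ - ‖y‖ ^ γ) • x‖ := norm_add_le _ _
    _ = ‖y‖ ^ γ * ‖x - y‖ + (‖x‖ ^ γ - ‖y‖ ^ γ) * ‖x‖ := by
        rw [norm_smul, norm_smul, Real.norm_of_nonneg htγ, Real.norm_of_nonneg (by linarith)]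
    _ ≤ ‖y‖ ^ γ * ‖x - y‖ + ‖x‖ ^ γ * ‖x - y‖ := by linarith [hkey]
    _ = (‖x‖ ^ γ + ‖y‖ ^ γ) * ‖x - y‖ := by ring

/-- The radial map inverts `W = (‖S‖²)^{b/2} S`: with `γ(1 + b) = −b`, `‖W‖^γ W = S`.
[folklore] -/
theorem rpow_smul_rpow_normSq_smul {b γ : ℝ} (hγ : γ * (1 + b) = -b) (S : E') :
    ‖(‖S‖ ^ 2) ^ (b / 2) • S‖ ^ γ • ((‖S‖ ^ 2) ^ (b / 2) • S) = S := by
  rcases eq_or_ne S 0 with hS | hS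
  · subst hS; simp
  have hn : 0 < ‖S‖ := norm_pos_iff.2 hS
  have e0 : (‖S‖ ^ 2) ^ (b / 2) = ‖S‖ ^ b := by
    rw [← Real.rpow_natCast, ← Real.rpow_mul hn.le]; congr 1; push_cast; ring
  have h1 : ‖(‖S‖ ^ 2) ^ (b / 2) • S‖ = ‖S‖ ^ (b + 1) := by
    rw [e0, norm_smul, Real.norm_of_nonneg (Real.rpow_nonneg hn.le _), Real.rpow_add hn,
      Real.rpow_one]
  have h2 : (‖S‖ ^ (b + 1)) ^ γ = ‖S‖ ^ (-b) := by
    rw [← Real.rpow_mul hn.le]; congr 1; linear_combination hγ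
  rw [h1, h2, e0, smul_smul, ← Real.rpow_add hn, neg_add_cancel, Real.rpow_zero, one_smul]

/-- `‖(‖S‖²)^{b/2} S‖² = (‖S‖²)^{b+1}` (`b + 1 ≠ 0`). [folklore] -/
theorem norm_rpow_normSq_smul_sq {b : ℝ} (hb : b + 1 ≠ 0) (S : E') :
    ‖(‖S‖ ^ 2) ^ (b / 2) • S‖ ^ 2 = (‖S‖ ^ 2) ^ (b + 1) := by
  have hn : 0 ≤ ‖S‖ ^ 2 := sq_nonneg _
  rw [norm_smul, Real.norm_of_nonneg (Real.rpow_nonneg hn _), mul_pow, ← Real.rpow_natCast,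
    ← Real.rpow_mul hn, Real.rpow_add' hn hb, Real.rpow_one]
  norm_num

end Radial

end TopEig

end Summit.NavierStokesRegularity.FunctionalMining
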